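import Literature.NumberTheory.LFunctions.Zhang2022.Section3Lemma32Flat
import HarnessLib

/-!
# Zhang (2022) §3, Lemma 3.2♭ on the LONG range: `∑_{D⁴ < n ≤ N} ν(n)²d(n)/n ≪ 𝓛^{-2007}` for all
# `N ≤ P² = exp(2𝓛⁹)` under (A), kernel-checked

Topic `Literature/NumberTheory/LFunctions/Zhang2022` (Landau–Siegel autopsy tree; verdict-neutral).
Y. Zhang, *Discrete mean estimates and the Landau–Siegel zero*, arXiv:2211.02515v1 — **an unrefereed
manuscript under adjudication** — §3, Lemmas 3.1–3.2 (p. 7). The tree's `Lemma32Flat.lemma_3_2_flat`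
proves the four-factor variant `∑_{D⁴<n≤N} ν(n)²d(n)/n ≤ C𝓛^{-2015}` for `N ≤ D⁸` (what Lemma 3.6
needed). THIS FILE extends the range to `N ≤ exp(2𝓛⁹) = P²` (the range of the tree's Lemma 3.1,
`Lemma31.lemma_3_1`), at the cost of eight logarithms: `≤ C𝓛^{-2007}` (`lemma_3_2_flat_long`).
Consumer: the §17.u021 remainder `R₁` in the χ-reading (WP16 leaf h17_9; the complement terms of the
`G`-truncated convolution `ν₁*` carry `ν(a)²` with `D⁴ < a ≤ D⁴T⁵ ≤ P²`).

The proof is the tree's, verbatim, with the smoothing pair `A = D⁴`, `B = D⁴·e^{2𝓛⁹}` (so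
`1_{(D⁴,N]} ≤ 6(e^{-n/B} − e^{-n/A})` for `N ≤ e^{2𝓛⁹} ≤ B`, `4A ≤ B`): every `A,B`-generic lemma of
`Section3Lemma32Flat` is re-used BY NAME (`sum_Ioc_le`, `integral_Fint_line_two`,
`norm_integral_Fint_line_le`, `Fint_horizontal_decay`, `differentiableOn_*`, `aux_logpow5`, …); only the
residue bound on the circle `|z| = 𝓛^{-2024}` is re-proved with the weaker size hypotheses
`log A, log B ≤ 𝓛^{2023}` (`norm_hnum_le_sphere_long`: the factor `ε(z) = B^z − A^z` still satisfies
`‖z‖log B ≤ 1`, and contributes `2(log A + log B) ≤ 6𝓛⁹` instead of `24𝓛`), whence Cauchy's estimate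
(`norm_iteratedDeriv_hnum_le_long`) and the assembly (`lemma_3_2_flat_long`, line term unchanged:
`A^{-1/4} + B^{-1/4} ≤ 2/D`). Theorems only; axioms standard. No statement about the manuscript's
Theorems 1–2 is made or implied.

## References

* Y. Zhang, arXiv:2211.02515 (2022), §3, Lemmas 3.1–3.2. [cite: Zhang2022LandauSiegel, §3, Lemma 3.2]
-/

noncomputable section

open Complex Filter Topology Set MeasureTheory Real Metric
open scoped LSeries.notation

namespace Literature.NumberTheory.LFunctions.Zhang2022.Lemma32Flat

open Literature.NumberTheory.LFunctions.DivisorSumCharSq (eps eps_of_ne_zero eps_zero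
  differentiable_eps W W_eq_tsum integral_Gamma_cpow_LSeries_eq integrable_Gamma_cpow_LSeries
  MX rpow_le_rpow_add Zconst Zconst_nonneg norm_LFunction_one_add_le)
open Literature.NumberTheory.LFunctions.Zhang2022.Lemma31 (W_ofReal summable_mul_exp_div
  one_sixth_le_exp_sub_exp norm_LFunction_le_near_one norm_LFunction_one_add_sub_le
  ne_one_of_isPrimitive divisorSumChar_im_eq_zero eight_lt_exp_three)
open Literature.NumberTheory.LFunctions.Zhang2022.PhiFlat (phiFlat factor differentiableOn_phiFlat
  norm_phiFlat_le norm_phiFlat_le_of_re_cpow_nonneg LSeries_nu_sq_tau_eq re_natCast_cpow_neg_nonneg)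
open Literature.NumberTheory.LFunctions.ZetaM4 (CΓ CΓ_pos norm_Gamma_strip_le pow_mul_exp_le
  integrable_pow_mul_exp integral_pow_mul_exp_le exists_pow_mul_exp_le)

variable {D : ℕ} [NeZero D] (χ : DirichletCharacter ℂ D)
variable {A B : ℝ}

/-! ### §1. The residue bound on the circle, long range -/

/-- **`h` on the circle `|z| = 𝓛^{-2024}`, long range** (`log A, log B ≤ 𝓛^{2023}` in place of
`≤ 8𝓛`): `‖h(z)‖ ≤ K_res · 2(log A + log B) · 𝓛^{-8088}`.
[cite: Zhang2022LandauSiegel, §3, proof of Lemma 3.1] -/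
theorem norm_hnum_le_sphere_long (hχ : χ ^ 2 = 1) (hprim : χ.IsPrimitive) (hL : 3 ≤ Real.log D)
    (hLA : ‖χ.LFunction 1‖ ≤ 1 / Real.log D ^ 2022) (hA1 : 1 ≤ A) (hB1 : 1 ≤ B)
    (hAL : Real.log A ≤ Real.log D ^ 2023) (hBL : Real.log B ≤ Real.log D ^ 2023) {z : ℂ}
    (hz : ‖z‖ = 1 / Real.log D ^ 2024) :
    ‖hnum χ A B z‖ ≤ Kres * (2 * (Real.log A + Real.log B)) / (Real.log D ^ 2022) ^ 4 := by
  set Lg : ℝ := Real.log D with hLdef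
  have hL1 : 1 ≤ Lg := by linarith
  have hL0 : 0 < Lg := by linarith
  have hD0 : D ≠ 0 := by
    rintro rfl; simp [hLdef] at hL; linarith
  have hDpos : (0 : ℝ) < D := by exact_mod_cast Nat.pos_of_ne_zero hD0
  have hlA : 0 ≤ Real.log A := Real.log_nonneg hA1
  have hlB : 0 ≤ Real.log B := Real.log_nonneg hB1
  -- sizes of `r = 𝓛^{-2024}`
  have hL2 : (9 : ℝ) ≤ Lg ^ 2024 := by
    calc (9 : ℝ) = 3 ^ 2 := by norm_num
      _ ≤ Lg ^ 2 := pow_le_pow_left₀ (by norm_num) hL 2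
      _ ≤ Lg ^ 2024 := pow_le_pow_right₀ hL1 (by norm_num)
  have hr9 : ‖z‖ ≤ 1 / 9 := by
    rw [hz]; exact div_le_div_of_nonneg_left (by norm_num) (by norm_num) hL2
  have hrL : ‖z‖ * Lg ≤ 1 / Lg ^ 2023 := by
    rw [hz]
    have : Lg ^ 2024 = Lg ^ 2023 * Lg := by rw [pow_succ]
    rw [this]; field_simp; exact le_rfl
  have hL2023 : (9 : ℝ) ≤ Lg ^ 2023 := by
    calc (9 : ℝ) = 3 ^ 2 := by norm_num
      _ ≤ Lg ^ 2 := pow_le_pow_left₀ (by norm_num) hL 2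
      _ ≤ Lg ^ 2023 := pow_le_pow_right₀ hL1 (by norm_num)
  have hrL1 : ‖z‖ * Lg ≤ 1 := hrL.trans (by rw [div_le_one (by positivity)]; linarith)
  have hrL8 : ‖z‖ * Lg ^ 2023 ≤ 1 := by
    rw [hz]
    have : Lg ^ 2024 = Lg ^ 2023 * Lg := by rw [pow_succ]
    rw [this, one_div, mul_comm, ← div_eq_mul_inv, div_le_one (by positivity)]
    calc Lg ^ 2023 = Lg ^ 2023 * 1 := by ring
      _ ≤ Lg ^ 2023 * Lg := by gcongr
  have hz0 : z ≠ 0 := by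
    intro h; rw [h, norm_zero] at hz
    have : (0 : ℝ) < 1 / Lg ^ 2024 := by positivity
    linarith
  have hz1L : ‖z‖ ≤ 1 / Real.log D := by
    rw [← hLdef]
    calc ‖z‖ = ‖z‖ * Lg / Lg := by field_simp
      _ ≤ 1 / Lg := by gcongr
  have hzre : |z.re| ≤ 1 / 9 := (Complex.abs_re_le_norm z).trans hr9
  have hzim : |z.im| ≤ ‖z‖ := Complex.abs_im_le_norm z
  -- ζ₁(1+z)⁴
  have h1z : ‖(1 : ℂ) + z‖ ≤ 5 / 4 := by
    have := norm_add_le (1 : ℂ) z; rw [norm_one] at this; linarith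
  have hζ₁ : ‖riemannZeta₁ (1 + z)‖ ≤ (13 / 4 : ℝ) ^ 4 := by
    have h := BurnolVectors.norm_riemannZeta₁_le (s := 1 + z)
      (by rw [add_re, one_re]; have := neg_abs_le z.re; linarith)
    refine h.trans ?_
    have : ‖(1 : ℂ) + z‖ + 2 ≤ 13 / 4 := by linarith
    exact pow_le_pow_left₀ (by positivity) this 4
  have hζ4 : ‖riemannZeta₁ (1 + z)‖ ^ 4 ≤ (13 / 4 : ℝ) ^ 16 := by
    calc ‖riemannZeta₁ (1 + z)‖ ^ 4 ≤ ((13 / 4 : ℝ) ^ 4) ^ 4 := pow_le_pow_left₀ (norm_nonneg _) hζ₁ 4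
      _ = (13 / 4 : ℝ) ^ 16 := by norm_num
  -- Γ(z+1)
  have hC := CΓ_pos
  have hΓ : ‖Complex.Gamma (z + 1)‖ ≤ 2 * CΓ := by
    have := norm_Gamma_strip_le (x := z.re + 1) (by have := neg_abs_le z.re; linarith)
      (by have := le_abs_self z.re; linarith) z.im
    have e : ((z.re + 1 : ℝ) : ℂ) + z.im * I = z + 1 := by
      rw [show ((z.re + 1 : ℝ) : ℂ) = (z.re : ℂ) + 1 by push_cast; ring]
      conv_rhs => rw [← Complex.re_add_im z]
      ring
    rw [e] at this
    refine this.trans ?_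
    have hy : |z.im| ≤ 1 / 9 := hzim.trans hr9
    have hE : Real.exp (-(π * |z.im| / 2)) ≤ 1 := by
      rw [Real.exp_le_one_iff]
      have := Real.pi_pos; have := abs_nonneg z.im
      nlinarith
    calc CΓ * (1 + |z.im|) ^ 3 * Real.exp (-(π * |z.im| / 2))
        ≤ CΓ * (1 + 1 / 9) ^ 3 * 1 := by gcongr
      _ ≤ 2 * CΓ := by nlinarith
  -- ε(z)
  have hε : ‖eps A B z‖ ≤ 2 * (Real.log A + Real.log B) :=
    norm_eps_le_small hA1 hB1 hz0
      ((mul_le_mul_of_nonneg_left hAL (norm_nonneg _)).trans hrL8)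
      ((mul_le_mul_of_nonneg_left hBL (norm_nonneg _)).trans hrL8)
  -- L(1+z, χ)⁴ under (A)
  have hLz : ‖χ.LFunction (1 + z)‖ ≤ (1 + 4 * Real.exp (9 / 2)) / Lg ^ 2022 := by
    have hsub := norm_LFunction_one_add_sub_le χ hL hprim hz1L
    rw [← hLdef] at hsub
    have htri := norm_add_le (χ.LFunction (1 + z) - χ.LFunction 1) (χ.LFunction 1)
    rw [sub_add_cancel] at htri
    have hE := Real.exp_pos (9 / 2)
    have h2 : 2 * Real.exp (9 / 2) * (1 + Lg) * Lg * ‖z‖ ≤ 4 * Real.exp (9 / 2) / Lg ^ 2022 := by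
      have h1L : 1 + Lg ≤ 2 * Lg := by linarith
      calc 2 * Real.exp (9 / 2) * (1 + Lg) * Lg * ‖z‖
          ≤ 2 * Real.exp (9 / 2) * (2 * Lg) * Lg * ‖z‖ := by gcongr
        _ = 4 * Real.exp (9 / 2) * Lg * (‖z‖ * Lg) := by ring
        _ ≤ 4 * Real.exp (9 / 2) * Lg * (1 / Lg ^ 2023) := by gcongr
        _ = 4 * Real.exp (9 / 2) / Lg ^ 2022 := by
            have : Lg ^ 2023 = Lg * Lg ^ 2022 := by rw [pow_succ']
            rw [this]; field_simp
    calc ‖χ.LFunction (1 + z)‖ ≤ ‖χ.LFunction (1 + z) - χ.LFunction 1‖ + ‖χ.LFunction 1‖ := htri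
      _ ≤ 2 * Real.exp (9 / 2) * (1 + Lg) * Lg * ‖z‖ + 1 / Lg ^ 2022 := add_le_add hsub hLA
      _ ≤ 4 * Real.exp (9 / 2) / Lg ^ 2022 + 1 / Lg ^ 2022 := by linarith
      _ = (1 + 4 * Real.exp (9 / 2)) / Lg ^ 2022 := by ring
  have hL4 : ‖χ.LFunction (1 + z)‖ ^ 4 ≤ (1 + 4 * Real.exp (9 / 2)) ^ 4 / (Lg ^ 2022) ^ 4 := by
    rw [← div_pow]; exact pow_le_pow_left₀ (norm_nonneg _) hLz 4
  -- φ♭(1+z): absolute bound near the real axis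
  have hφ : ‖phiFlat χ (1 + z)‖ ≤ Real.exp (35 * Psum) := by
    refine norm_phiFlat_le_of_re_cpow_nonneg χ hχ (σ₀ := 3 / 4) (by norm_num) (s := 1 + z)
      (by rw [add_re, one_re]; have := neg_abs_le z.re; linarith) fun p hp hpD => ?_
    refine re_natCast_cpow_neg_nonneg hp.pos ?_
    have hpD' : (p : ℝ) ≤ D := by exact_mod_cast Nat.le_of_dvd (Nat.pos_of_ne_zero hD0) hpD
    have hlogp : Real.log p ≤ Lg := Real.log_le_log (by exact_mod_cast hp.pos) hpD'
    have hlogp0 : 0 ≤ Real.log p := Real.log_nonneg (by exact_mod_cast hp.one_lt.le)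
    have him : |(1 + z : ℂ).im| = |z.im| := by simp
    rw [him]
    calc |z.im| * Real.log p ≤ ‖z‖ * Lg := mul_le_mul hzim hlogp hlogp0 (norm_nonneg _)
      _ ≤ 1 := hrL1
      _ ≤ π / 2 := by linarith [Real.pi_gt_three]
  have hg : ‖gF χ z‖ ≤ (1 + 4 * Real.exp (9 / 2)) ^ 4 / (Lg ^ 2022) ^ 4 * Real.exp (35 * Psum) := by
    rw [gF, norm_mul, norm_pow]
    exact mul_le_mul hL4 hφ (norm_nonneg _) (by positivity)
  -- combine
  have s1 : ‖riemannZeta₁ (1 + z)‖ ^ 4 * ‖Complex.Gamma (z + 1)‖ ≤ (13 / 4 : ℝ) ^ 16 * (2 * CΓ) :=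
    mul_le_mul hζ4 hΓ (norm_nonneg _) (by positivity)
  have s2 : ‖riemannZeta₁ (1 + z)‖ ^ 4 * ‖Complex.Gamma (z + 1)‖ * ‖eps A B z‖ ≤
      (13 / 4 : ℝ) ^ 16 * (2 * CΓ) * (2 * (Real.log A + Real.log B)) :=
    mul_le_mul s1 hε (norm_nonneg _) (by positivity)
  have s3 : ‖riemannZeta₁ (1 + z)‖ ^ 4 * ‖Complex.Gamma (z + 1)‖ * ‖eps A B z‖ * ‖gF χ z‖ ≤
      (13 / 4 : ℝ) ^ 16 * (2 * CΓ) * (2 * (Real.log A + Real.log B)) *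
        ((1 + 4 * Real.exp (9 / 2)) ^ 4 / (Lg ^ 2022) ^ 4 * Real.exp (35 * Psum)) :=
    mul_le_mul s2 hg (norm_nonneg _) (by positivity)
  rw [hnum, norm_mul, norm_mul, norm_mul, norm_pow]
  refine s3.trans (le_of_eq ?_)
  rw [Kres]; field_simp


/-- **Cauchy's estimate for the residue, long range**: `‖h‴(0)‖ ≤ 3!·K_res·2(log A + log B)·𝓛^{-8088}/𝓛^{-3·2024}`.
[cite: Zhang2022LandauSiegel, §3, proof of Lemma 3.1] -/
theorem norm_iteratedDeriv_hnum_le_long (hχ : χ ^ 2 = 1) (hprim : χ.IsPrimitive) (hL : 3 ≤ Real.log D)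
    (hLA : ‖χ.LFunction 1‖ ≤ 1 / Real.log D ^ 2022) (hA1 : 1 ≤ A) (hB1 : 1 ≤ B)
    (hAL : Real.log A ≤ Real.log D ^ 2023) (hBL : Real.log B ≤ Real.log D ^ 2023) :
    ‖iteratedDeriv 3 (hnum χ A B) 0‖ ≤
      (Nat.factorial 3 : ℝ) * (Kres * (2 * (Real.log A + Real.log B)) / (Real.log D ^ 2022) ^ 4) /
        (1 / Real.log D ^ 2024) ^ 3 := by
  have hL1 : 1 ≤ Real.log D := by linarith
  have hD0 : D ≠ 0 := by
    rintro rfl; simp at hL; linarith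
  have hq2 : 2 ≤ D := by
    rcases Nat.lt_or_ge D 2 with h | h
    · interval_cases D <;> norm_num at hL
    · exact h
  have hχ1 := ne_one_of_isPrimitive χ hq2 hprim
  set r : ℝ := 1 / Real.log D ^ 2024 with hr
  have hr0 : 0 < r := by positivity
  have hL2 : (9 : ℝ) ≤ Real.log D ^ 2024 := by
    calc (9 : ℝ) = 3 ^ 2 := by norm_num
      _ ≤ Real.log D ^ 2 := pow_le_pow_left₀ (by norm_num) hL 2
      _ ≤ Real.log D ^ 2024 := pow_le_pow_right₀ hL1 (by norm_num)
  have hr9 : r ≤ 1 / 9 := div_le_div_of_nonneg_left (by norm_num) (by norm_num) hL2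
  have hd : DiffContOnCl ℂ (hnum χ A B) (ball 0 r) := by
    refine (differentiableOn_hnum χ hχ hχ1 (by linarith) (by linarith)).diffContOnCl_ball
      fun z hz => ?_
    rw [mem_closedBall, dist_zero_right] at hz
    simp only [mem_setOf_eq]
    have := Complex.abs_re_le_norm z
    have := neg_abs_le z.re
    linarith
  have hM : ∀ z ∈ sphere (0 : ℂ) r,
      ‖hnum χ A B z‖ ≤ Kres * (2 * (Real.log A + Real.log B)) / (Real.log D ^ 2022) ^ 4 := by
    intro z hz
    rw [mem_sphere, dist_zero_right] at hz
    exact norm_hnum_le_sphere_long χ hχ hprim hL hLA hA1 hB1 hAL hBL hz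
  exact Complex.norm_iteratedDeriv_le_of_forall_mem_sphere_norm_le 3 hr0 hd hM


/-! ### §2. The smoothing pair `A = D⁴`, `B = D⁴e^{2𝓛⁹}` and the long-range lemma -/

omit [NeZero D] in
/-- Elementary facts about `A = D⁴`, `B = D⁴·e^{2𝓛⁹}` for `𝓛 = log D ≥ 3` (`P = e^{𝓛⁹}`, (2.6)).
[cite: Zhang2022LandauSiegel, §2 (2.6)] -/
theorem aux_AB_long (hL : 3 ≤ Real.log D) :
    0 < (D : ℝ) ^ 4 ∧ 4 * (D : ℝ) ^ 4 ≤ (D : ℝ) ^ 4 * Real.exp (2 * Real.log D ^ 9) ∧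
    ((D : ℝ) ^ 4) ^ (-(1 / 4) : ℝ) + ((D : ℝ) ^ 4 * Real.exp (2 * Real.log D ^ 9)) ^ (-(1 / 4) : ℝ) ≤
      2 / D ∧
    1 ≤ (D : ℝ) ^ 4 ∧ 1 ≤ (D : ℝ) ^ 4 * Real.exp (2 * Real.log D ^ 9) ∧
    Real.log ((D : ℝ) ^ 4) ≤ Real.log D ^ 2023 ∧
    Real.log ((D : ℝ) ^ 4 * Real.exp (2 * Real.log D ^ 9)) ≤ Real.log D ^ 2023 ∧
    Real.log ((D : ℝ) ^ 4) + Real.log ((D : ℝ) ^ 4 * Real.exp (2 * Real.log D ^ 9)) ≤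
      3 * Real.log D ^ 9 := by
  set Lg : ℝ := Real.log D with hLdef
  have hD0 : (0 : ℝ) < D := by
    rcases Nat.eq_zero_or_pos D with h | h
    · rw [h] at hLdef; rw [hLdef] at hL; simp at hL; linarith
    · exact_mod_cast h
  have hD8 : (8 : ℝ) ≤ D := by
    have h1 : Real.exp 3 ≤ Real.exp (Real.log D) := Real.exp_le_exp.2 hL
    rw [Real.exp_log hD0] at h1
    linarith [eight_lt_exp_three]
  have hD1 : (1 : ℝ) ≤ D := by linarith
  have hL1 : 1 ≤ Lg := by linarith
  have hE := Real.exp_pos (2 * Lg ^ 9)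
  have hE4 : (4 : ℝ) ≤ Real.exp (2 * Lg ^ 9) := by
    have h2 : (2 : ℝ) ≤ 2 * Lg ^ 9 := by nlinarith [one_le_pow₀ (M₀ := ℝ) hL1 (n := 9)]
    have := Real.add_one_le_exp (2 * Lg ^ 9)
    have h3 : Real.exp 2 ≤ Real.exp (2 * Lg ^ 9) := Real.exp_le_exp.2 h2
    have h4 : (4 : ℝ) ≤ Real.exp 2 := by
      have := Real.add_one_le_exp (1 : ℝ)
      have e2 : Real.exp 2 = Real.exp 1 * Real.exp 1 := by rw [← Real.exp_add]; norm_num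
      rw [e2]; nlinarith [Real.exp_pos (1:ℝ)]
    linarith
  have hA4 : (1 : ℝ) ≤ (D : ℝ) ^ 4 := one_le_pow₀ hD1
  have hlogA : Real.log ((D : ℝ) ^ 4) = 4 * Lg := by rw [Real.log_pow]; push_cast; rw [hLdef]
  have hlogB : Real.log ((D : ℝ) ^ 4 * Real.exp (2 * Lg ^ 9)) = 4 * Lg + 2 * Lg ^ 9 := by
    rw [Real.log_mul (by positivity) hE.ne', Real.log_exp, hlogA]
  have hL9 : 8 * Lg ≤ Lg ^ 9 := by
    have h8 : (8 : ℝ) ≤ Lg ^ 8 := by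
      calc (8 : ℝ) ≤ 3 ^ 8 := by norm_num
        _ ≤ Lg ^ 8 := pow_le_pow_left₀ (by norm_num) hL 8
    calc 8 * Lg ≤ Lg ^ 8 * Lg := by nlinarith
      _ = Lg ^ 9 := by ring
  have hL2023 : 3 * Lg ^ 9 ≤ Lg ^ 2023 := by
    have h3 : (3 : ℝ) ≤ Lg ^ 2014 := by
      calc (3 : ℝ) = 3 ^ 1 := by norm_num
        _ ≤ (3 : ℝ) ^ 2014 := pow_le_pow_right₀ (by norm_num) (by norm_num)
        _ ≤ Lg ^ 2014 := pow_le_pow_left₀ (by norm_num) hL 2014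
    calc 3 * Lg ^ 9 ≤ Lg ^ 2014 * Lg ^ 9 := by gcongr
      _ = Lg ^ 2023 := by rw [← pow_add]
  refine ⟨by positivity, ?_, ?_, hA4, ?_, ?_, ?_, ?_⟩
  · nlinarith [pow_nonneg hD0.le 4]
  · have e1 : ((D : ℝ) ^ 4) ^ (-(1 / 4) : ℝ) = 1 / D := by
      rw [← Real.rpow_natCast, ← Real.rpow_mul hD0.le]; norm_num
      exact Real.rpow_neg_one _
    have e2 : ((D : ℝ) ^ 4 * Real.exp (2 * Lg ^ 9)) ^ (-(1 / 4) : ℝ) ≤ 1 / D := by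
      rw [← e1]
      exact Real.rpow_le_rpow_of_nonpos (by positivity) (by nlinarith [pow_nonneg hD0.le 4])
        (by norm_num)
    have h2D : 2 / (D : ℝ) = 1 / D + 1 / D := by ring
    rw [h2D, e1]; linarith
  · nlinarith
  · rw [hlogA]; linarith
  · rw [hlogB]; linarith
  · rw [hlogA, hlogB]; linarith

/-- **Lemma 3.2♭ on the long range, kernel-checked**: there is an absolute `C` such that for every `D`
with `log D ≥ 3`, every primitive `χ` mod `D` with `χ² = 1` satisfying (A) `‖L(1,χ)‖ ≤ (log D)^{-2022}`,
and every `N ≤ exp(2(log D)⁹) = P²`, `∑_{D⁴ < n ≤ N} |ν(n)|² d(n)/n ≤ C (log D)^{-2007}`.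
[cite: Zhang2022LandauSiegel, §3, Lemma 3.2 (variant ν²τ₂, long range)] -/
theorem lemma_3_2_flat_long : ∃ C : ℝ, ∀ (D : ℕ) [NeZero D] (χ : DirichletCharacter ℂ D),
    χ.IsPrimitive → χ ^ 2 = 1 → 3 ≤ Real.log D →
    ‖χ.LFunction 1‖ ≤ 1 / Real.log D ^ 2022 →
    ∀ N : ℕ, (N : ℝ) ≤ Real.exp (2 * Real.log D ^ 9) →
      ∑ n ∈ Finset.Ioc (D ^ 4) N, ‖divisorSumChar χ n‖ ^ 2 * (n.divisors.card : ℝ) / n ≤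
        C / Real.log D ^ 2007 := by
  obtain ⟨Cd, hCd1, hCd⟩ := Sieve.exists_card_divisors_le_mul_rpow (by norm_num : (0 : ℝ) < 1 / 8)
  refine ⟨6 * (6 * Kres + 2 * 48 ^ 23 * KlineFlat * Cd ^ 2 * (2 * (32 * 8080 ^ 2020))), ?_⟩
  intro D _ χ hprim hχ2 hL hA N hN
  set M : ℝ := (8080 : ℝ) ^ 2020 with hM
  clear_value M
  set M' : ℝ := (48 : ℝ) ^ 23 with hM'
  clear_value M'
  set Lg : ℝ := Real.log D with hLdef
  have hL1 : 1 ≤ Lg := by linarith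
  have hL0 : 0 < Lg := by linarith
  have hD0 : D ≠ 0 := by
    rintro rfl; simp [hLdef] at hL; linarith
  have hDpos : (0 : ℝ) < D := by exact_mod_cast Nat.pos_of_ne_zero hD0
  have hD8 : 8 ≤ D := by
    have h1 : Real.exp 3 ≤ Real.exp Lg := Real.exp_le_exp.2 hL
    rw [hLdef, Real.exp_log hDpos] at h1
    have := eight_lt_exp_three
    exact_mod_cast (show (8 : ℝ) ≤ D by linarith)
  have hχ1 := ne_one_of_isPrimitive χ (by omega) hprim
  obtain ⟨hApos, h4AB, hABsum, hA1, hB1, hlogA, hlogB, hlogAB⟩ := aux_AB_long (D := D) hL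
  set A : ℝ := (D : ℝ) ^ 4 with hAdef
  set B : ℝ := (D : ℝ) ^ 4 * Real.exp (2 * Real.log D ^ 9) with hBdef
  have hBpos : 0 < B := by linarith
  -- (1) smoothing
  have hNB : (N : ℝ) ≤ B := by
    refine hN.trans ?_
    rw [hBdef]
    have h1 : (1 : ℝ) ≤ (D : ℝ) ^ 4 := hA1
    nlinarith [Real.exp_pos (2 * Real.log D ^ 9)]
  have hS := sum_Ioc_le χ hχ2 hApos h4AB (M := D ^ 4) (N := N)
    (by rw [hAdef]; push_cast; exact le_rfl) hNB
  -- (2) the contour shift across the pole of order four at `z = 0`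
  set U : Set ℂ := {z : ℂ | -(1 / 2) < z.re} with hU
  have hUo : IsOpen U := isOpen_lt continuous_const Complex.continuous_re
  have hstrip := Literature.Analysis.Complex.integral_vertical_sub_eq_sum_of_poles
    (F := Fint χ A B) (σ₁ := -(1 / 4)) (κ := 2) (by norm_num) ({0} : Finset ℂ) (fun _ => 3)
    (fun _ => hnum χ A B) U hUo
    (fun z hz => by
      simp only [mem_preimage, mem_Icc] at hz
      show -(1 / 2) < z.re
      linarith [hz.1])
    (fun p hp => by rw [Finset.mem_singleton] at hp; rw [hp]; simp)
    (by rw [Finset.coe_singleton]; exact differentiableOn_Fint χ hχ2 hχ1 hApos hBpos)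
    (fun p hp => by
      rw [Finset.mem_singleton] at hp
      subst hp
      refine ⟨U, hUo.mem_nhds (by simp [hU]), differentiableOn_hnum χ hχ2 hχ1 hApos hBpos,
        fun z hz hz0 => ?_⟩
      refine Fint_eq_hnum_div χ hz0 fun m hm => ?_
      have hzre : -(1 / 2) < z.re := hz
      rw [hm] at hzre hz0
      simp at hzre
      have : m = 0 := by
        by_contra h
        have : (1 : ℝ) ≤ m := by exact_mod_cast Nat.one_le_iff_ne_zero.2 h
        linarith
      subst this
      simp at hz0)
    (integrable_Fint_line χ hχ2 hχ1 hApos hBpos (Or.inr rfl))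
    (integrable_Fint_line χ hχ2 hχ1 hApos hBpos (Or.inl rfl))
    (Fint_horizontal_decay χ hχ2 hχ1 hApos hBpos)
  rw [Finset.sum_singleton] at hstrip
  -- the line `re z = 2`
  have h2 := (integral_Fint_line_two χ hχ2 hApos hBpos).2
  have e2 : (∫ t : ℝ, Fint χ A B (((2 : ℝ) : ℂ) + t * I)) = ∫ t : ℝ, Fint χ A B (2 + t * I) := by
    norm_num
  rw [e2, h2] at hstrip
  -- so `2π (W(B) − W(A)) = 2π · h‴(0)/3! + ∫_{re z = −1/4} F`
  have hX : 2 * (π : ℂ) * (W (coeff χ) B - W (coeff χ) A) =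
      2 * π * (iteratedDeriv 3 (hnum χ A B) 0 / ((Nat.factorial 3 : ℕ) : ℂ)) +
        ∫ t : ℝ, Fint χ A B ((((-(1 / 4) : ℝ)) : ℂ) + t * I) := sub_eq_iff_eq_add.1 hstrip
  have h2π : ‖(2 * (π : ℂ))‖ = 2 * π := by
    rw [norm_mul, Complex.norm_ofNat, Complex.norm_real, Real.norm_eq_abs, abs_of_pos Real.pi_pos]
  have hnormX : 2 * π * ‖W (coeff χ) B - W (coeff χ) A‖ ≤
      2 * π * ‖iteratedDeriv 3 (hnum χ A B) 0 / ((Nat.factorial 3 : ℕ) : ℂ)‖ +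
        ‖∫ t : ℝ, Fint χ A B ((((-(1 / 4) : ℝ)) : ℂ) + t * I)‖ := by
    have h := congrArg (fun w : ℂ => ‖w‖) hX
    simp only [norm_mul, h2π] at h
    rw [h]
    refine (norm_add_le _ _).trans (le_of_eq ?_)
    rw [norm_mul, h2π]
  have hΔn0 : ‖W (coeff χ) B - W (coeff χ) A‖ ≤
      ‖iteratedDeriv 3 (hnum χ A B) 0 / ((Nat.factorial 3 : ℕ) : ℂ)‖ +
        ‖∫ t : ℝ, Fint χ A B ((((-(1 / 4) : ℝ)) : ℂ) + t * I)‖ := by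
    have hπ3 := Real.pi_gt_three
    have hI0 := norm_nonneg (∫ t : ℝ, Fint χ A B ((((-(1 / 4) : ℝ)) : ℂ) + t * I))
    have h1 : ‖∫ t : ℝ, Fint χ A B ((((-(1 / 4) : ℝ)) : ℂ) + t * I)‖ ≤
        2 * π * ‖∫ t : ℝ, Fint χ A B ((((-(1 / 4) : ℝ)) : ℂ) + t * I)‖ := by nlinarith
    have h2 : 2 * π * ‖W (coeff χ) B - W (coeff χ) A‖ ≤
        2 * π * (‖iteratedDeriv 3 (hnum χ A B) 0 / ((Nat.factorial 3 : ℕ) : ℂ)‖ +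
          ‖∫ t : ℝ, Fint χ A B ((((-(1 / 4) : ℝ)) : ℂ) + t * I)‖) := by linarith
    exact le_of_mul_le_mul_left h2 (by positivity)
  -- (3) the residue term
  have hres := norm_iteratedDeriv_hnum_le_long χ hχ2 hprim hL hA hA1 hB1 hlogA hlogB
  have hfac : ((Nat.factorial 3 : ℕ) : ℝ) = 6 := by norm_num [Nat.factorial]
  have hT1 : ‖iteratedDeriv 3 (hnum χ A B) 0 / ((Nat.factorial 3 : ℕ) : ℂ)‖ ≤ 6 * Kres / Lg ^ 2007 := by
    rw [norm_div, Complex.norm_natCast, hfac]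
    rw [hfac, ← hLdef] at hres
    have hK := Kres_nonneg
    have hsum : Real.log A + Real.log B ≤ 3 * Lg ^ 9 := by rw [← hLdef] at hlogAB; exact hlogAB
    have step : 6 * (Kres * (2 * (Real.log A + Real.log B)) / (Lg ^ 2022) ^ 4) / (1 / Lg ^ 2024) ^ 3 ≤
        6 * (Kres * (2 * (3 * Lg ^ 9)) / (Lg ^ 2022) ^ 4) / (1 / Lg ^ 2024) ^ 3 := by
      gcongr
    have e : 6 * (Kres * (2 * (3 * Lg ^ 9)) / (Lg ^ 2022) ^ 4) / (1 / Lg ^ 2024) ^ 3 =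
        6 * (6 * Kres / Lg ^ 2007) := by
      have h8088 : (Lg ^ 2022) ^ 4 = Lg ^ 2007 * Lg ^ 9 * (Lg ^ 2024) ^ 3 := by
        rw [← pow_mul, ← pow_mul, ← pow_add, ← pow_add]
      rw [h8088]
      field_simp
      ring
    rw [div_le_iff₀ (by norm_num : (0 : ℝ) < 6)]
    calc ‖iteratedDeriv 3 (hnum χ A B) 0‖
        ≤ 6 * (Kres * (2 * (Real.log A + Real.log B)) / (Lg ^ 2022) ^ 4) / (1 / Lg ^ 2024) ^ 3 := hres
      _ ≤ 6 * (6 * Kres / Lg ^ 2007) := step.trans (le_of_eq e)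
      _ = 6 * Kres / Lg ^ 2007 * 6 := by ring
  -- (4) the shifted integral
  have hT2 : ‖∫ t : ℝ, Fint χ A B ((((-(1 / 4) : ℝ)) : ℂ) + t * I)‖ ≤
      2 * M' * KlineFlat * Cd ^ 2 * (2 * (32 * M)) / Lg ^ 2015 := by
    have hI := norm_integral_Fint_line_le χ hχ2 hprim hD8 hApos hBpos
    rw [← hM'] at hI
    set t : ℝ := (D : ℝ) ^ (1 / 8 : ℝ) with htdef
    have ht0 : 0 < t := by positivity
    have ht2 : (D : ℝ) ^ (1 / 4 : ℝ) = t ^ 2 := by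
      rw [htdef, ← Real.rpow_natCast, ← Real.rpow_mul hDpos.le]; norm_num
    have ht4 : Real.sqrt D = t ^ 4 := by
      rw [Real.sqrt_eq_rpow, htdef, ← Real.rpow_natCast, ← Real.rpow_mul hDpos.le]; norm_num
    have ht8 : (D : ℝ) = t ^ 8 := by
      rw [htdef, ← Real.rpow_natCast, ← Real.rpow_mul hDpos.le]; norm_num
    have hτ : (D.divisors.card : ℝ) ≤ Cd * t := hCd D hD0
    have hτ2 : (D.divisors.card : ℝ) ^ 2 ≤ (Cd * t) ^ 2 := pow_le_pow_left₀ (Nat.cast_nonneg _) hτ 2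
    have hlp := aux_logpow5 (D := D) hL1 hDpos
    rw [ht2, ← hLdef, ← hM] at hlp
    have hK := KlineFlat_pos
    have hM'0 : 0 ≤ M' := by rw [hM']; positivity
    have hmain : KlineFlat * (D.divisors.card : ℝ) ^ 2 * Real.sqrt D * (1 + Lg) ^ 5 *
        (A ^ (-(1 / 4) : ℝ) + B ^ (-(1 / 4) : ℝ)) ≤ KlineFlat * Cd ^ 2 * (2 * (32 * M / Lg ^ 2015)) := by
      calc KlineFlat * (D.divisors.card : ℝ) ^ 2 * Real.sqrt D * (1 + Lg) ^ 5 *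
            (A ^ (-(1 / 4) : ℝ) + B ^ (-(1 / 4) : ℝ))
          ≤ KlineFlat * (Cd * t) ^ 2 * t ^ 4 * (1 + Lg) ^ 5 * (2 / D) := by
            rw [ht4]; gcongr
        _ = KlineFlat * Cd ^ 2 * (2 * ((1 + Lg) ^ 5 / t ^ 2)) := by
            rw [ht8]; field_simp
        _ ≤ KlineFlat * Cd ^ 2 * (2 * (32 * M / Lg ^ 2015)) := by gcongr
    calc ‖∫ t : ℝ, Fint χ A B ((((-(1 / 4) : ℝ)) : ℂ) + t * I)‖
        ≤ 2 * M' * (KlineFlat * (D.divisors.card : ℝ) ^ 2 * Real.sqrt D * (1 + Real.log D) ^ 5 *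
            (A ^ (-(1 / 4) : ℝ) + B ^ (-(1 / 4) : ℝ))) := hI
      _ ≤ 2 * M' * (KlineFlat * Cd ^ 2 * (2 * (32 * M / Lg ^ 2015))) := by
          rw [← hLdef]; gcongr
      _ = 2 * M' * KlineFlat * Cd ^ 2 * (2 * (32 * M)) / Lg ^ 2015 := by ring
  -- (5) combine
  have hT2' : ‖∫ t : ℝ, Fint χ A B ((((-(1 / 4) : ℝ)) : ℂ) + t * I)‖ ≤
      2 * M' * KlineFlat * Cd ^ 2 * (2 * (32 * M)) / Lg ^ 2007 := by
    refine hT2.trans (div_le_div_of_nonneg_left ?_ (by positivity) ?_)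
    · have := KlineFlat_pos
      have hM0 : 0 ≤ M := by rw [hM]; positivity
      have hM'0 : 0 ≤ M' := by rw [hM']; positivity
      positivity
    · exact pow_le_pow_right₀ hL1 (by norm_num)
  have hΔn : ‖W (coeff χ) B - W (coeff χ) A‖ ≤
      (6 * Kres + 2 * M' * KlineFlat * Cd ^ 2 * (2 * (32 * M))) / Lg ^ 2007 := by
    refine hΔn0.trans ?_
    rw [add_div]
    exact add_le_add hT1 hT2'
  calc ∑ n ∈ Finset.Ioc (D ^ 4) N, ‖divisorSumChar χ n‖ ^ 2 * (n.divisors.card : ℝ) / n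
      ≤ 6 * (W (coeff χ) B - W (coeff χ) A).re := hS
    _ ≤ 6 * ‖W (coeff χ) B - W (coeff χ) A‖ := by gcongr; exact Complex.re_le_norm _
    _ ≤ 6 * ((6 * Kres + 2 * M' * KlineFlat * Cd ^ 2 * (2 * (32 * M))) / Lg ^ 2007) := by gcongr
    _ = _ := by rw [hLdef]; ring

end Literature.NumberTheory.LFunctions.Zhang2022.Lemma32Flat

end
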